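import Summits.SmoothPoincare4.SmoothPoincare4.Theorems.EntropyRungCompactShrinkerGapJensenVolumeBound
import Literature.Geometry.Riemannian.GurskyEinsteinGap
import HarnessLib

/-!
# The Einstein endgame of line `cgy-variance-pivot`
(stub `stub_einsteinEndgame`, crux `EntropyRung.CompactShrinkerGap`, item stmt-SmoothPoincare4-10870)

The crux: a normalised gradient shrinker `Ric + Hess f = g/2`, `R + |∇f|² = f` on a closed homotopy
`4`-sphere `M ≃ₕ S⁴` with Gaussian mass `∫ e^{-f} dV > 32π²√π e^{-3/2}` lives on `M ≅ S⁴`. This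
file proves its EINSTEIN corner `Hess f ≡ 0`, GIVEN the two named Literature facts threaded as
hypotheses — Gursky's Einstein gap on homotopy `4`-spheres
(`gursky_einstein_homotopySphere_four`, `GurskyEinsteinGap.lean`) and Hamilton's PIC sphere theorem
(`hamilton_pic_sphere_four`, `PICSphereFacts.lean`):

* `Hess f = 0` and the soliton equation give `Ric = ½ g` pointwise;
* `gursky_einstein_homotopySphere_four.diffeomorph_sphere_or_volume_le` (PROVED corollary of the
  two facts, `λ = ½`) returns `M ≅ S⁴` or `Vol(M, g) ≤ 8π²/(½)² = 32π²`;
* the second alternative contradicts the landed volume floor `volume_floor_of_density`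
  (`32π²√π e^{1/2} < Vol(M, g)`, p71839) because `√π · e^{1/2} > 1`
  (`thirtyTwo_pi_sq_lt_thirtyTwo_pi_sq_mul_sqrt_pi_mul_exp_half`).

Everything here is proved from the two threaded hypotheses; no definition, no new named fact.

## References

* M. J. Gursky, Math. Ann. 318 (2000) 417–431, Theorem 1. [Gursky2000]
* R. S. Hamilton, Comm. Anal. Geom. 5 (1997) 1–92, Cor. 1.2 (a). [Hamilton1997]
* H.-D. Cao, R. S. Hamilton, T. Ilmanen, arXiv:math/0404165 (2004), §4. [CaoHamiltonIlmanen2004]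
-/

noncomputable section

-- the registered namespace `Summit.SmoothPoincare4.SmoothPoincare4.Theorems` repeats a component
set_option linter.dupNamespace false

open MeasureTheory Set
open scoped Manifold ContDiff ENNReal Topology ContinuousMap

namespace Summit.SmoothPoincare4.SmoothPoincare4.Theorems

open Literature.Geometry Literature.Geometry.Lorentzian Literature.Geometry.Riemannian
  Literature.Geometry.Lorentzian.PseudoRiemannianMetric

/-- **Numerics of the Einstein endgame**: `32π² < 32π²√π e^{1/2}`, i.e. `1 < √π · e^{1/2}`
(`√π > 1` since `π > 3 > 1`, and `e^{1/2} > 1`). [folklore] -/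
theorem thirtyTwo_pi_sq_lt_thirtyTwo_pi_sq_mul_sqrt_pi_mul_exp_half :
    32 * Real.pi ^ 2 < 32 * Real.pi ^ 2 * Real.sqrt Real.pi * Real.exp (1 / 2) := by
  have h1 : 1 < Real.sqrt Real.pi := by
    rw [show (1 : ℝ) = Real.sqrt 1 by simp]
    exact Real.sqrt_lt_sqrt (by norm_num) (by linarith [Real.pi_gt_three])
  have h2 : 1 < Real.exp (1 / 2 : ℝ) := Real.one_lt_exp_iff.2 (by norm_num)
  have h32 : 0 < 32 * Real.pi ^ 2 := by positivity
  have h12 : 1 < Real.sqrt Real.pi * Real.exp (1 / 2 : ℝ) := by nlinarith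
  calc 32 * Real.pi ^ 2 = 32 * Real.pi ^ 2 * 1 := (mul_one _).symm
    _ < 32 * Real.pi ^ 2 * (Real.sqrt Real.pi * Real.exp (1 / 2 : ℝ)) :=
        mul_lt_mul_of_pos_left h12 h32
    _ = 32 * Real.pi ^ 2 * Real.sqrt Real.pi * Real.exp (1 / 2) := by ring

/-- **The Einstein endgame (registered stub `stub_einsteinEndgame` of line `cgy-variance-pivot`).**
GIVEN Gursky's Einstein gap on homotopy `4`-spheres (`gursky_einstein_homotopySphere_four`) and
Hamilton's PIC sphere theorem (`hamilton_pic_sphere_four`): a smooth normalised gradient shrinker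
`Ric + Hess f = g/2`, `R + |∇f|² = f` on a closed `M ≃ₕ S⁴` with Gaussian mass
`∫ e^{-f} dV > 32π²√π e^{-3/2}` and `Hess f ≡ 0` lives on `M ≅ S⁴`. Proof: `Ric = ½ g`, so
`diffeomorph_sphere_or_volume_le` (`λ = ½`) gives `M ≅ S⁴` or `Vol ≤ ofReal (8π²/(½)²) = ofReal (32π²)`,
and the latter contradicts the volume floor `32π²√π e^{1/2} < Vol` (`volume_floor_of_density`)
since `√π e^{1/2} > 1`. [cite: Gursky2000, Theorem 1] [cite: Hamilton1997, Cor. 1.2(a)]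
[cite: CaoHamiltonIlmanen2004, §4] -/
theorem stub_einsteinEndgame :
    Literature.Geometry.Riemannian.gursky_einstein_homotopySphere_four →
    Literature.Geometry.Riemannian.hamilton_pic_sphere_four →
    ∀ (M : Type) [TopologicalSpace M] [T2Space M] [SecondCountableTopology M]
      [ChartedSpace (EuclideanSpace ℝ (Fin 4)) M] [IsManifold (𝓡 4) ∞ M] [CompactSpace M]
      [T3Space M] [MeasurableSpace M] [BorelSpace M],
      M ≃ₕ Metric.sphere (0 : EuclideanSpace ℝ (Fin 5)) 1 →
    ∀ (g : Literature.Geometry.Lorentzian.PseudoRiemannianMetric (𝓡 4) ∞ (EuclideanSpace ℝ (Fin 4))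
        (TangentSpace (𝓡 4) : M → Type _)) [g.HasLeviCivita] (f : M → ℝ) (hg : g.IsRiemannian),
      ContMDiff (𝓡 4) 𝓘(ℝ, ℝ) ∞ f →
      (∀ (x : M) (X Y : TangentSpace (𝓡 4) x),
        g.ricci x X Y + g.hessian f x X Y = (1 / 2 : ℝ) * g.val x X Y) →
      (∀ x : M, g.scalarCurvature x + g.gradSq f x = f x) →
      ENNReal.ofReal (32 * Real.pi ^ 2 * Real.sqrt Real.pi * Real.exp (-(3 : ℝ) / 2)) <
        ∫⁻ x, ENNReal.ofReal (Real.exp (-f x))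
          ∂(Literature.Geometry.Lorentzian.riemannianMeasure (g.toContMDiffRiemannianMetric hg)) →
      (∀ (x : M) (X Y : TangentSpace (𝓡 4) x), g.hessian f x X Y = 0) →
      Nonempty (M ≃ₘ⟮𝓡 4, 𝓡 4⟯ (Metric.sphere (0 : EuclideanSpace ℝ (Fin 5)) 1)) := by
  intro hG hPIC M _ _ _ _ _ _ _ _ _ e g _ f hg hf hsol hnorm hdens hE
  -- `Hess f = 0` and the soliton equation: `Ric = ½ g`
  have hRic : ∀ (x : M) (X Y : TangentSpace (𝓡 4) x),
      g.ricci x X Y = (1 / 2 : ℝ) * g.val x X Y := fun x X Y ↦ by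
    have h := hsol x X Y
    rwa [hE x X Y, add_zero] at h
  rcases gursky_einstein_homotopySphere_four.diffeomorph_sphere_or_volume_le M g hG hPIC e hg
      (by norm_num : (0 : ℝ) < 1 / 2) hRic with hdiff | hvol
  · exact hdiff
  · exfalso
    have h32 : (8 * Real.pi ^ 2 / (1 / 2 : ℝ) ^ 2) = 32 * Real.pi ^ 2 := by ring
    rw [h32] at hvol
    -- the finite volume, read in `ℝ`, is at most `32π²` …
    have hle : (riemannianMeasure (g.toContMDiffRiemannianMetric hg) Set.univ).toReal ≤
        32 * Real.pi ^ 2 :=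
      ENNReal.toReal_le_of_le_ofReal (by positivity) hvol
    -- … but exceeds `32π²√π e^{1/2} > 32π²` by the landed volume floor
    have hV := volume_floor_of_density M g f hg hf hsol hnorm hdens
    linarith [thirtyTwo_pi_sq_lt_thirtyTwo_pi_sq_mul_sqrt_pi_mul_exp_half]

end Summit.SmoothPoincare4.SmoothPoincare4.Theorems
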